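import Summits.QuantumFields.YangMills.Theorems.BalabanLadderNTReferenceTransferTempered
import HarnessLib

/-!
# Seam `UVSeamRec` (stmt-QuantumFields-20043): TEMPERED law of total cumulance (third order) — oscillation bounds only
# on a GOOD set of exteriors, plus a rarity remainder (generic layer for the tempered three-point transfer)

Helper file (`--supports stmt-QuantumFields-20043`; owner R78: THREE-POINT CONJUNCT supplier; lead ym-spine-20043-p1
g7 09:44Z located suggestion «tempered twin of `Reference.abs_torusK3_sub_kerK3_le`») of the fleet lead prover of crux
`NT` (unit `ym-spine-19353-p1`, g5); route-independent.  CLAUSE SERVED: conjunct 3 (three-point floor) of the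
registered v4-F `stub_floorsEngine` in TEMPERED currency.  The tempered twin of g4's
`abs_cum3_sub_integral_condCum3_le_of_osc` (`…NTReferenceTransfer.lean` §1): the exact decomposition
`κ₃ − ∫κ₃(·|ext) = ∫ D`, `D = Σᵢ (Fᵢ − mᵢ)(C_{jk} − c_{jk}) + ∏(Fᵢ − mᵢ)` (Brillinger) is unchanged; the pointwise bound
on `D` is taken ON the good set `S` with the tempered deviations `kᵢ + 2Mᵢδ`, `w_{jk} + 2M_{jk}δ`
(`…TransferTempered.abs_sub_integral_le_of_osc_on`) and OFF `S` with the crude `2Mᵢ`, `2M_{jk}`, the latter weighted by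
`μ(Sᶜ) ≤ δ`:

* **`abs_cum3_sub_integral_condCum3_le_of_osc_on`** —
  `|κ₃ − ∫ κ₃(·|ext)| ≤ [k₁′w₂₃′ + k₂′w₁₃′ + k₃′w₁₂′ + k₁′k₂′k₃′] + [4(M₁M₂₃ + M₂M₁₃ + M₃M₁₂) + 8M₁M₂M₃]·δ`,
  `kᵢ′ = kᵢ + 2Mᵢδ`, `w_{jk}′ = w_{jk} + 2M_{jk}δ` (`M_{jk}` a bound of the conditional covariance `F_{jk} − F_jF_k`).

At `δ = 0`, `S = univ` this is g4's bound.  Torus specialisation (tempered `abs_torusK3_sub_torusE_kerK3_le` /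
`abs_torusK3_sub_torusK3_le` / `triple_transfer` / `q3_floor`) = the successor's next files (HANDOFF of g5).

Refs: lead line fleet INBOX 2026-08-27T09:44:53Z; g4 `…NTReferenceTransfer.lean` §1; D. R. Brillinger, *The calculation of
cumulants via conditioning*, Ann. Inst. Statist. Math. 21 (1969) 215–218 (law of total cumulance).
-/

set_option autoImplicit false

noncomputable section

open MeasureTheory Filter Topology
open Summit.QuantumFields.YangMills.Theorems.OSLegsFromFemtoAndGap.StubLower (integrable_of_continuous_compact)
open Literature.Probability.Moments (abs_integral_le_of_forall_abs_le)

namespace Summit.QuantumFields.YangMills.Cruxes.NT.Reference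

section MomentsOn

variable {Ω : Type*} [TopologicalSpace Ω] [CompactSpace Ω] [MeasurableSpace Ω]
  [OpensMeasurableSpace Ω] {μ : Measure Ω} [IsProbabilityMeasure μ]

omit [TopologicalSpace Ω] [CompactSpace Ω] [OpensMeasurableSpace Ω] in
/-- A function bounded by `M` is within `2M` of its mean everywhere (probability measure). [folklore] -/
theorem abs_sub_integral_le_two_mul {g : Ω → ℝ} {M : ℝ} (hM : ∀ ω, |g ω| ≤ M) (ω : Ω) :
    |g ω - ∫ ω', g ω' ∂μ| ≤ 2 * M := by
  calc |g ω - ∫ ω', g ω' ∂μ| ≤ |g ω| + |∫ ω', g ω' ∂μ| := abs_sub _ _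
    _ ≤ M + M := add_le_add (hM ω) (abs_integral_le_of_forall_abs_le hM)
    _ = 2 * M := by ring

/-- **TEMPERED law of total cumulance (third order), two-sided.**  Continuous conditional expectations
`F₁, F₂, F₃, F₁₂, F₁₃, F₂₃, F₁₂₃` of `A, B, C, AB, AC, BC, ABC` given the exterior, bounds `|Fᵢ| ≤ Mᵢ` and
`|F_{jk} − F_jF_k| ≤ M_{jk}`; a measurable GOOD set `S` of exteriors with `μ(Sᶜ) ≤ δ` on which the one-point values
oscillate by at most `kᵢ` and the conditional covariances by at most `w_{jk}` (all `≥ 0`).  Then the total third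
cumulant is within `[k₁′w₂₃′ + k₂′w₁₃′ + k₃′w₁₂′ + k₁′k₂′k₃′] + [4(M₁M₂₃ + M₂M₁₃ + M₃M₁₂) + 8M₁M₂M₃]·δ` of the mean
conditional third cumulant, `kᵢ′ = kᵢ + 2Mᵢδ`, `w_{jk}′ = w_{jk} + 2M_{jk}δ`. [folklore] -/
theorem abs_cum3_sub_integral_condCum3_le_of_osc_on {F₁ F₂ F₃ F₁₂ F₁₃ F₂₃ F₁₂₃ : Ω → ℝ}
    (h₁ : Continuous F₁) (h₂ : Continuous F₂) (h₃ : Continuous F₃) (h₁₂ : Continuous F₁₂)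
    (h₁₃ : Continuous F₁₃) (h₂₃ : Continuous F₂₃) (h₁₂₃ : Continuous F₁₂₃)
    {S : Set Ω} (hS : MeasurableSet S) {δ : ℝ} (hδ : μ.real Sᶜ ≤ δ)
    {M₁ M₂ M₃ M₂₃ M₁₃ M₁₂ : ℝ} (hM₁ : ∀ ω, |F₁ ω| ≤ M₁) (hM₂ : ∀ ω, |F₂ ω| ≤ M₂) (hM₃ : ∀ ω, |F₃ ω| ≤ M₃)
    (hM₂₃ : ∀ ω, |F₂₃ ω - F₂ ω * F₃ ω| ≤ M₂₃) (hM₁₃ : ∀ ω, |F₁₃ ω - F₁ ω * F₃ ω| ≤ M₁₃)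
    (hM₁₂ : ∀ ω, |F₁₂ ω - F₁ ω * F₂ ω| ≤ M₁₂)
    {k₁ k₂ k₃ w₁₂ w₁₃ w₂₃ : ℝ} (hk₁ : 0 ≤ k₁) (hk₂ : 0 ≤ k₂) (hk₃ : 0 ≤ k₃) (hw₁₂0 : 0 ≤ w₁₂)
    (hw₁₃0 : 0 ≤ w₁₃) (hw₂₃0 : 0 ≤ w₂₃)
    (ho₁ : ∀ ω ∈ S, ∀ ω' ∈ S, |F₁ ω - F₁ ω'| ≤ k₁) (ho₂ : ∀ ω ∈ S, ∀ ω' ∈ S, |F₂ ω - F₂ ω'| ≤ k₂)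
    (ho₃ : ∀ ω ∈ S, ∀ ω' ∈ S, |F₃ ω - F₃ ω'| ≤ k₃)
    (hw₂₃ : ∀ ω ∈ S, ∀ ω' ∈ S, |(F₂₃ ω - F₂ ω * F₃ ω) - (F₂₃ ω' - F₂ ω' * F₃ ω')| ≤ w₂₃)
    (hw₁₃ : ∀ ω ∈ S, ∀ ω' ∈ S, |(F₁₃ ω - F₁ ω * F₃ ω) - (F₁₃ ω' - F₁ ω' * F₃ ω')| ≤ w₁₃)
    (hw₁₂ : ∀ ω ∈ S, ∀ ω' ∈ S, |(F₁₂ ω - F₁ ω * F₂ ω) - (F₁₂ ω' - F₁ ω' * F₂ ω')| ≤ w₁₂) :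
    |((∫ ω, F₁₂₃ ω ∂μ) - (∫ ω, F₁ ω ∂μ) * (∫ ω, F₂₃ ω ∂μ) - (∫ ω, F₂ ω ∂μ) * (∫ ω, F₁₃ ω ∂μ)
        - (∫ ω, F₃ ω ∂μ) * (∫ ω, F₁₂ ω ∂μ) + 2 * ((∫ ω, F₁ ω ∂μ) * (∫ ω, F₂ ω ∂μ) * (∫ ω, F₃ ω ∂μ)))
      - ∫ ω, (F₁₂₃ ω - F₁ ω * F₂₃ ω - F₂ ω * F₁₃ ω - F₃ ω * F₁₂ ω + 2 * (F₁ ω * F₂ ω * F₃ ω)) ∂μ|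
      ≤ ((k₁ + 2 * M₁ * δ) * (w₂₃ + 2 * M₂₃ * δ) + (k₂ + 2 * M₂ * δ) * (w₁₃ + 2 * M₁₃ * δ)
          + (k₃ + 2 * M₃ * δ) * (w₁₂ + 2 * M₁₂ * δ) + (k₁ + 2 * M₁ * δ) * (k₂ + 2 * M₂ * δ) * (k₃ + 2 * M₃ * δ))
        + (4 * (M₁ * M₂₃ + M₂ * M₁₃ + M₃ * M₁₂) + 8 * M₁ * M₂ * M₃) * δ := by
  set m₁ := ∫ ω, F₁ ω ∂μ with hm₁
  set m₂ := ∫ ω, F₂ ω ∂μ with hm₂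
  set m₃ := ∫ ω, F₃ ω ∂μ with hm₃
  set c₂₃ := ∫ ω, (F₂₃ ω - F₂ ω * F₃ ω) ∂μ with hc₂₃
  set c₁₃ := ∫ ω, (F₁₃ ω - F₁ ω * F₃ ω) ∂μ with hc₁₃
  set c₁₂ := ∫ ω, (F₁₂ ω - F₁ ω * F₂ ω) ∂μ with hc₁₂
  have hδ0 : 0 ≤ δ := le_trans measureReal_nonneg hδ
  have hM₁0 : 0 ≤ M₁ := (abs_nonneg _).trans (abs_integral_le_of_forall_abs_le (μ := μ) hM₁)
  have hM₂0 : 0 ≤ M₂ := (abs_nonneg _).trans (abs_integral_le_of_forall_abs_le (μ := μ) hM₂)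
  have hM₃0 : 0 ≤ M₃ := (abs_nonneg _).trans (abs_integral_le_of_forall_abs_le (μ := μ) hM₃)
  have hM₂₃0 : 0 ≤ M₂₃ := (abs_nonneg _).trans (abs_integral_le_of_forall_abs_le (μ := μ) hM₂₃)
  have hM₁₃0 : 0 ≤ M₁₃ := (abs_nonneg _).trans (abs_integral_le_of_forall_abs_le (μ := μ) hM₁₃)
  have hM₁₂0 : 0 ≤ M₁₂ := (abs_nonneg _).trans (abs_integral_le_of_forall_abs_le (μ := μ) hM₁₂)
  have I : ∀ {f : Ω → ℝ}, Continuous f → Integrable f μ := fun hf => integrable_of_continuous_compact hf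
  have hC₂₃c : Continuous fun ω => F₂₃ ω - F₂ ω * F₃ ω := h₂₃.sub (h₂.mul h₃)
  have hC₁₃c : Continuous fun ω => F₁₃ ω - F₁ ω * F₃ ω := h₁₃.sub (h₁.mul h₃)
  have hC₁₂c : Continuous fun ω => F₁₂ ω - F₁ ω * F₂ ω := h₁₂.sub (h₁.mul h₂)
  -- tempered deviations on the good set
  have hd₁ : ∀ ω ∈ S, |F₁ ω - m₁| ≤ k₁ + 2 * M₁ * δ := fun ω hω => abs_sub_integral_le_of_osc_on h₁ hS hM₁ ho₁ hδ hω
  have hd₂ : ∀ ω ∈ S, |F₂ ω - m₂| ≤ k₂ + 2 * M₂ * δ := fun ω hω => abs_sub_integral_le_of_osc_on h₂ hS hM₂ ho₂ hδ hω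
  have hd₃ : ∀ ω ∈ S, |F₃ ω - m₃| ≤ k₃ + 2 * M₃ * δ := fun ω hω => abs_sub_integral_le_of_osc_on h₃ hS hM₃ ho₃ hδ hω
  have hdC₂₃ : ∀ ω ∈ S, |(F₂₃ ω - F₂ ω * F₃ ω) - c₂₃| ≤ w₂₃ + 2 * M₂₃ * δ :=
    fun ω hω => abs_sub_integral_le_of_osc_on hC₂₃c hS hM₂₃ hw₂₃ hδ hω
  have hdC₁₃ : ∀ ω ∈ S, |(F₁₃ ω - F₁ ω * F₃ ω) - c₁₃| ≤ w₁₃ + 2 * M₁₃ * δ :=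
    fun ω hω => abs_sub_integral_le_of_osc_on hC₁₃c hS hM₁₃ hw₁₃ hδ hω
  have hdC₁₂ : ∀ ω ∈ S, |(F₁₂ ω - F₁ ω * F₂ ω) - c₁₂| ≤ w₁₂ + 2 * M₁₂ * δ :=
    fun ω hω => abs_sub_integral_le_of_osc_on hC₁₂c hS hM₁₂ hw₁₂ hδ hω
  -- crude deviations everywhere
  have he₁ : ∀ ω, |F₁ ω - m₁| ≤ 2 * M₁ := abs_sub_integral_le_two_mul hM₁
  have he₂ : ∀ ω, |F₂ ω - m₂| ≤ 2 * M₂ := abs_sub_integral_le_two_mul hM₂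
  have he₃ : ∀ ω, |F₃ ω - m₃| ≤ 2 * M₃ := abs_sub_integral_le_two_mul hM₃
  have heC₂₃ : ∀ ω, |(F₂₃ ω - F₂ ω * F₃ ω) - c₂₃| ≤ 2 * M₂₃ := abs_sub_integral_le_two_mul hM₂₃
  have heC₁₃ : ∀ ω, |(F₁₃ ω - F₁ ω * F₃ ω) - c₁₃| ≤ 2 * M₁₃ := abs_sub_integral_le_two_mul hM₁₃
  have heC₁₂ : ∀ ω, |(F₁₂ ω - F₁ ω * F₂ ω) - c₁₂| ≤ 2 * M₁₂ := abs_sub_integral_le_two_mul hM₁₂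
  have hz : ∀ {F : Ω → ℝ}, Continuous F → ∫ ω, (F ω - ∫ ω', F ω' ∂μ) ∂μ = 0 := by
    intro F hF
    rw [integral_sub (I hF) (integrable_const _), integral_const]
    simp
  -- the scalar third cumulant as one integral
  have iT₁ : Integrable (fun ω => F₁₂₃ ω - m₁ * F₂₃ ω) μ := (I h₁₂₃).sub ((I h₂₃).const_mul m₁)
  have iT₂ : Integrable (fun ω => F₁₂₃ ω - m₁ * F₂₃ ω - m₂ * F₁₃ ω) μ := iT₁.sub ((I h₁₃).const_mul m₂)
  have iT : Integrable (fun ω => F₁₂₃ ω - m₁ * F₂₃ ω - m₂ * F₁₃ ω - m₃ * F₁₂ ω) μ :=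
    iT₂.sub ((I h₁₂).const_mul m₃)
  have hlin : (∫ ω, F₁₂₃ ω ∂μ) - m₁ * (∫ ω, F₂₃ ω ∂μ) - m₂ * (∫ ω, F₁₃ ω ∂μ)
      - m₃ * (∫ ω, F₁₂ ω ∂μ) + 2 * (m₁ * m₂ * m₃) =
      ∫ ω, (F₁₂₃ ω - m₁ * F₂₃ ω - m₂ * F₁₃ ω - m₃ * F₁₂ ω + 2 * (m₁ * m₂ * m₃)) ∂μ := by
    rw [integral_add iT (integrable_const _), integral_sub iT₂ ((I h₁₂).const_mul m₃),
      integral_sub iT₁ ((I h₁₃).const_mul m₂), integral_sub (I h₁₂₃) ((I h₂₃).const_mul m₁),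
      integral_const_mul, integral_const_mul, integral_const_mul, integral_const]
    simp only [probReal_univ, smul_eq_mul, one_mul]
  -- the fluctuation part `D` and the mean-zero part `R`
  set D : Ω → ℝ := fun ω => (F₁ ω - m₁) * ((F₂₃ ω - F₂ ω * F₃ ω) - c₂₃)
      + (F₂ ω - m₂) * ((F₁₃ ω - F₁ ω * F₃ ω) - c₁₃) + (F₃ ω - m₃) * ((F₁₂ ω - F₁ ω * F₂ ω) - c₁₂)
      + (F₁ ω - m₁) * (F₂ ω - m₂) * (F₃ ω - m₃) with hD
  set R : Ω → ℝ := fun ω => (c₂₃ - m₂ * m₃) * (F₁ ω - m₁) + (c₁₃ - m₁ * m₃) * (F₂ ω - m₂)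
      + (c₁₂ - m₁ * m₂) * (F₃ ω - m₃) with hR
  have hDc : Continuous D := by simp only [hD]; fun_prop
  have hRc : Continuous R := by simp only [hR]; fun_prop
  have hcondc : Continuous fun ω =>
      F₁₂₃ ω - F₁ ω * F₂₃ ω - F₂ ω * F₁₃ ω - F₃ ω * F₁₂ ω + 2 * (F₁ ω * F₂ ω * F₃ ω) := by fun_prop
  have hpt : (fun ω => (F₁₂₃ ω - m₁ * F₂₃ ω - m₂ * F₁₃ ω - m₃ * F₁₂ ω + 2 * (m₁ * m₂ * m₃))
      - (F₁₂₃ ω - F₁ ω * F₂₃ ω - F₂ ω * F₁₃ ω - F₃ ω * F₁₂ ω + 2 * (F₁ ω * F₂ ω * F₃ ω)))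
      = fun ω => D ω + R ω := by
    funext ω; simp only [hD, hR]; ring
  have hRz : ∫ ω, R ω ∂μ = 0 := by
    have j₁ : Integrable (fun ω => (c₂₃ - m₂ * m₃) * (F₁ ω - m₁)) μ :=
      (I (h₁.sub continuous_const)).const_mul _
    have j₂ : Integrable (fun ω => (c₁₃ - m₁ * m₃) * (F₂ ω - m₂)) μ :=
      (I (h₂.sub continuous_const)).const_mul _
    have j₃ : Integrable (fun ω => (c₁₂ - m₁ * m₂) * (F₃ ω - m₃)) μ :=
      (I (h₃.sub continuous_const)).const_mul _
    have j₁₂ : Integrable (fun ω => (c₂₃ - m₂ * m₃) * (F₁ ω - m₁) + (c₁₃ - m₁ * m₃) * (F₂ ω - m₂)) μ :=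
      j₁.add j₂
    simp only [hR]
    rw [integral_add j₁₂ j₃, integral_add j₁ j₂, integral_const_mul, integral_const_mul,
      integral_const_mul, hz h₁, hz h₂, hz h₃]
    ring
  have hdiff : ((∫ ω, F₁₂₃ ω ∂μ) - m₁ * (∫ ω, F₂₃ ω ∂μ) - m₂ * (∫ ω, F₁₃ ω ∂μ)
      - m₃ * (∫ ω, F₁₂ ω ∂μ) + 2 * (m₁ * m₂ * m₃))
      - ∫ ω, (F₁₂₃ ω - F₁ ω * F₂₃ ω - F₂ ω * F₁₃ ω - F₃ ω * F₁₂ ω + 2 * (F₁ ω * F₂ ω * F₃ ω)) ∂μ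
      = ∫ ω, D ω ∂μ := by
    have iT' : Integrable (fun ω => F₁₂₃ ω - m₁ * F₂₃ ω - m₂ * F₁₃ ω - m₃ * F₁₂ ω
        + 2 * (m₁ * m₂ * m₃)) μ := iT.add (integrable_const _)
    rw [hlin, ← integral_sub iT' (I hcondc)]
    rw [show (fun ω => (F₁₂₃ ω - m₁ * F₂₃ ω - m₂ * F₁₃ ω - m₃ * F₁₂ ω + 2 * (m₁ * m₂ * m₃))
      - (F₁₂₃ ω - F₁ ω * F₂₃ ω - F₂ ω * F₁₃ ω - F₃ ω * F₁₂ ω + 2 * (F₁ ω * F₂ ω * F₃ ω)))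
      = fun ω => D ω + R ω from hpt]
    rw [integral_add (I hDc) (I hRc), hRz, add_zero]
  rw [hdiff, ← Real.norm_eq_abs]
  have amul : ∀ {x y u w : ℝ}, |x| ≤ u → |y| ≤ w → |x * y| ≤ u * w := fun hx hy => by
    rw [abs_mul]; exact mul_le_mul hx hy (abs_nonneg _) ((abs_nonneg _).trans hx)
  -- the two pointwise bounds
  obtain ⟨Bg, hBg⟩ : ∃ Bg : ℝ, Bg = (k₁ + 2 * M₁ * δ) * (w₂₃ + 2 * M₂₃ * δ)
      + (k₂ + 2 * M₂ * δ) * (w₁₃ + 2 * M₁₃ * δ) + (k₃ + 2 * M₃ * δ) * (w₁₂ + 2 * M₁₂ * δ)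
      + (k₁ + 2 * M₁ * δ) * (k₂ + 2 * M₂ * δ) * (k₃ + 2 * M₃ * δ) := ⟨_, rfl⟩
  obtain ⟨Bb, hBb⟩ : ∃ Bb : ℝ, Bb = 4 * (M₁ * M₂₃ + M₂ * M₁₃ + M₃ * M₁₂) + 8 * M₁ * M₂ * M₃ := ⟨_, rfl⟩
  have hBb0 : 0 ≤ Bb := by rw [hBb]; positivity
  have hBg0 : 0 ≤ Bg := by rw [hBg]; positivity
  have hDgood : ∀ ω ∈ S, |D ω| ≤ Bg := fun ω hω => by
    have b₁ := amul (hd₁ ω hω) (hdC₂₃ ω hω)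
    have b₂ := amul (hd₂ ω hω) (hdC₁₃ ω hω)
    have b₃ := amul (hd₃ ω hω) (hdC₁₂ ω hω)
    have b₄ := amul (amul (hd₁ ω hω) (hd₂ ω hω)) (hd₃ ω hω)
    have t₁ := abs_add_le ((F₁ ω - m₁) * ((F₂₃ ω - F₂ ω * F₃ ω) - c₂₃)
      + (F₂ ω - m₂) * ((F₁₃ ω - F₁ ω * F₃ ω) - c₁₃) + (F₃ ω - m₃) * ((F₁₂ ω - F₁ ω * F₂ ω) - c₁₂))
      ((F₁ ω - m₁) * (F₂ ω - m₂) * (F₃ ω - m₃))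
    have t₂ := abs_add_le ((F₁ ω - m₁) * ((F₂₃ ω - F₂ ω * F₃ ω) - c₂₃)
      + (F₂ ω - m₂) * ((F₁₃ ω - F₁ ω * F₃ ω) - c₁₃)) ((F₃ ω - m₃) * ((F₁₂ ω - F₁ ω * F₂ ω) - c₁₂))
    have t₃ := abs_add_le ((F₁ ω - m₁) * ((F₂₃ ω - F₂ ω * F₃ ω) - c₂₃))
      ((F₂ ω - m₂) * ((F₁₃ ω - F₁ ω * F₃ ω) - c₁₃))
    simp only [hD]
    rw [hBg]
    linarith
  have hDbad : ∀ ω, |D ω| ≤ Bb := fun ω => by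
    have b₁ := amul (he₁ ω) (heC₂₃ ω)
    have b₂ := amul (he₂ ω) (heC₁₃ ω)
    have b₃ := amul (he₃ ω) (heC₁₂ ω)
    have b₄ := amul (amul (he₁ ω) (he₂ ω)) (he₃ ω)
    have t₁ := abs_add_le ((F₁ ω - m₁) * ((F₂₃ ω - F₂ ω * F₃ ω) - c₂₃)
      + (F₂ ω - m₂) * ((F₁₃ ω - F₁ ω * F₃ ω) - c₁₃) + (F₃ ω - m₃) * ((F₁₂ ω - F₁ ω * F₂ ω) - c₁₂))
      ((F₁ ω - m₁) * (F₂ ω - m₂) * (F₃ ω - m₃))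
    have t₂ := abs_add_le ((F₁ ω - m₁) * ((F₂₃ ω - F₂ ω * F₃ ω) - c₂₃)
      + (F₂ ω - m₂) * ((F₁₃ ω - F₁ ω * F₃ ω) - c₁₃)) ((F₃ ω - m₃) * ((F₁₂ ω - F₁ ω * F₂ ω) - c₁₂))
    have t₃ := abs_add_le ((F₁ ω - m₁) * ((F₂₃ ω - F₂ ω * F₃ ω) - c₂₃))
      ((F₂ ω - m₂) * ((F₁₃ ω - F₁ ω * F₃ ω) - c₁₃))
    simp only [hD]
    rw [hBb]
    linarith
  have hpt' : ∀ᵐ ω ∂μ, ‖D ω‖ ≤ Bg + Bb * Sᶜ.indicator (fun _ => (1 : ℝ)) ω := ae_of_all _ fun ω => by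
    rw [Real.norm_eq_abs]
    by_cases hω : ω ∈ S
    · have : Sᶜ.indicator (fun _ => (1 : ℝ)) ω = 0 := Set.indicator_of_notMem (by simpa using hω) _
      rw [this, mul_zero, add_zero]
      exact hDgood ω hω
    · have : Sᶜ.indicator (fun _ => (1 : ℝ)) ω = 1 := Set.indicator_of_mem (by simpa using hω) _
      rw [this, mul_one]
      linarith [hDbad ω, hBg0]
  have key := norm_integral_le_of_norm_le (integrable_const_add_mul_indicator hS.compl Bg Bb) hpt'
  rw [integral_const_add_mul_indicator hS.compl] at key
  calc ‖∫ ω, D ω ∂μ‖ ≤ Bg + Bb * μ.real Sᶜ := key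
    _ ≤ Bg + Bb * δ := by nlinarith [measureReal_nonneg (μ := μ) (s := Sᶜ)]
    _ = _ := by rw [hBg, hBb]

end MomentsOn

end Summit.QuantumFields.YangMills.Cruxes.NT.Reference

end
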